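import Summits.MatrixMultiplication.OmegaCensus.SmallFormats.InvertiblePointFootprintExclusion
import Summits.MatrixMultiplication.OmegaCensus.SmallFormats.MatMul227GF3Enumeration
import HarnessLib

/-!
# ω-census family (a): `⟨2,2,7⟩ @ 23` over `𝔽₃` — the rung's last engine input reduced to a pencil catalog

Cell `pub-omega` (unit `pub-omega-tensor-g32`), topic `Summits/MatrixMultiplication/OmegaCensus` (sub-folder `SmallFormats`).
Framing (verbatim): lottery ticket; floor = certified bounds/negative ranges. HONEST FRAMING: an ASSEMBLY. After `Enum723`
(p623966: the enumeration hypothesis is a theorem) the sentence `24 ≤ R_𝔽₃(⟨2,2,7⟩)` rests on the exclusion of the three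
explicit marginals `REP 0/1/2`. This file rewrites that exclusion, via the transpose move (`forall_xMarginal_ne_of_transpose`)
and the footprint reduction (`xMarginal_ne_of_catalog`), as: a catalog `cat` of 9-tuples of `2 × 7` matrices over `𝔽₃` that is
COMPLETE (`CatalogComplete 7 9 cat` — for the engine: the 1 068 Weierstraß–Kronecker types of `9 × 7` pencils, a published
classification NOT proved here) and against which the three TRANSPOSED representatives FAIL RADO at the saturated points
`X₀ = 1, diag(1,2), 1` (decidable `𝔽₃` linear algebra, NOT supplied here; the census' footprint filter reports 0 surviving types
for each, tensor g32 `reptrans.py`). The saturation of these points is checked by `decide` below. NOT a proof of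
`24 ≤ R_𝔽₃(⟨2,2,7⟩)`; nothing on `ω`.
-/

namespace Summit.MatrixMultiplication.OmegaCensus.SmallFormats.Enum723

open Module Matrix Literature.Computability.AlgebraicComplexity RankOnePlaneCapGeneral

/-- The transposed representative `j`: `i ↦ (REP j i)ᵀ` (in the `InOrbit` class of `REP j`). -/
def REPT (j : ℕ) : Fin 23 → Matrix (Fin 2) (Fin 2) (ZMod 3) := fun i => (REP j i)ᵀ

/-- The chosen invertible points: `1` for `j = 0, 2`, `diag(1, 2)` for `j = 1`. -/
def satPoint (j : ℕ) : Matrix (Fin 2) (Fin 2) (ZMod 3) := if j = 1 then !![1, 0; 0, 2] else 1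

/-- The chosen points are invertible. -/
theorem isUnit_det_satPoint (j : ℕ) : IsUnit (satPoint j).det := by
  unfold satPoint
  split_ifs
  · exact isUnit_iff_ne_zero.mpr (by decide)
  · rw [Matrix.det_one]; exact isUnit_one

/-- The chosen points are SATURATED for the transposed representatives: exactly `9 = 23 − 2·7` forms vanish there. -/
theorem card_vanishing_satPoint : ∀ j, j < 3 →
    (Finset.univ.filter fun i => formOf (REPT j i) (satPoint j) = 0).card + 2 * 7 = 23 := by
  decide

/-- **`24 ≤ R_𝔽₃(⟨2,2,7⟩)` from a complete `(9,7)` catalog and three Rado-failure tables.** IF `cat` is complete for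
9-dimensional column-supported subspaces of `𝔽₃^{2×7}` up to `GL₇` (input (C)), and each transposed representative
`REPT j` (`j < 3`) fails Rado against every member of `cat` at `satPoint j` (input (R)), THEN `24 ≤ R_𝔽₃(⟨2,2,7⟩)`
(and `≤ 25`, Hopcroft–Kerr). Inputs (C) and (R) are NOT proved here. -/
theorem twentyfour_le_tensorRank_227_gf3_of_catalog (cat : List (Fin 9 → Matrix (Fin 2) (Fin 7) (ZMod 3)))
    (hcat : CatalogComplete 7 9 cat) (hkill : ∀ j, j < 3 → ∀ b ∈ cat, RadoFails (REPT j) (satPoint j) b) :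
    24 ≤ tensorRank (matMulTensor (ZMod 3) 2 2 7) := by
  refine twentyfour_le_tensorRank_227_gf3_of_exclusion fun j hj => ?_
  refine forall_xMarginal_ne_of_transpose fun β => ?_
  exact xMarginal_ne_of_catalog (REPT j) (satPoint j) (isUnit_det_satPoint j) (card_vanishing_satPoint j hj)
    (by norm_num) cat hcat (hkill j hj) β

/-- The same with the Hopcroft–Kerr ceiling: `R_𝔽₃(⟨2,2,7⟩) ∈ [24, 25]` from inputs (C) and (R). -/
theorem tensorRank_227_gf3_mem_of_catalog (cat : List (Fin 9 → Matrix (Fin 2) (Fin 7) (ZMod 3)))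
    (hcat : CatalogComplete 7 9 cat) (hkill : ∀ j, j < 3 → ∀ b ∈ cat, RadoFails (REPT j) (satPoint j) b) :
    tensorRank (matMulTensor (ZMod 3) 2 2 7) ∈ Set.Icc 24 25 :=
  tensorRank_227_gf3_mem_of_exclusion fun j hj =>
    forall_xMarginal_ne_of_transpose fun β =>
      xMarginal_ne_of_catalog (REPT j) (satPoint j) (isUnit_det_satPoint j) (card_vanishing_satPoint j hj)
        (by norm_num) cat hcat (hkill j hj) β

end Summit.MatrixMultiplication.OmegaCensus.SmallFormats.Enum723
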